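import Mathlib
import Summits.Ventures.PercRepro2.SwAllMarkStepJunctions
import Summits.Ventures.PercRepro2.SwOutAdjGTyped

/-!
# THE GENERAL MARK STEP, VII: any set of junctions (adjacent junctions allowed)
(blind cell PercRepro2, night-4 g32, 2026-08-28; proofs/NIGHT4-G32.md §4)

With the adjacent-junction theorem on the general doubly typed side
(`gTypedSwAll_of_adjJunctions`, SwOutAdjGTyped) the general mark step settles g11's
adjacent-junction class of the isolated graph: **`swAll_markStep_of_adjJunctions`** — ANY set `J`
of junctions (no vertex of `{l, h, x}`; each without loop; the neighbours of a junction other than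
`h` and `x` — junction neighbours included — joined to `h`), every other vertex joined to `l` or
hanging on the mark; g31's `swAll_markStep_of_junctions` without the independence of `J`.
On the pattern `d` the junctions that are red neighbours of the mark are exempt, the others form
the set `J ∖ R(d)` (adjacent junctions allowed) to which the conditions on `h`'s clusters are blind.
Instance: `exA` = `0–1, 0–2, 1–3, 1–4, 2–3, 2–4, 3–4` with `l = 0`, `h = 1`, the mark `2` — the
two ADJACENT junctions `3 ~ 4`, both joined to `h` and to the mark (g29 §10 (c)'s core pair with
the mark on both): **`swAll_exA : SwAll exA 0 1 2`** — the last of the 2,040 (graph, marking)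
pairs at `n = 5` outside every theorem of record before this step (census, NIGHT4-G32.md §1).
-/

namespace Summit.Ventures.PercRepro2

namespace LocRows

open Hull

variable {V : Type*} {E : Type*} [Fintype E] [DecidableEq E]

open scoped Classical

variable {ends : E → Sym2 V} {x l h : V}

/-- **THE GENERAL MARK STEP WITH ANY SET OF JUNCTIONS** (g11's adjacent-junction class of the
isolated graph): junctions `J` not containing `l, h, x`, without loops, adjacent junctions
allowed, their neighbours other than `h` and `x` — junction neighbours included — joined to `h`;
every other vertex joined to `l` or hanging on the mark. -/
theorem swAll_markStep_of_adjJunctions (hlh : l ≠ h) (hloop : ∀ e, ends e ≠ s(h, h))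
    (hxl : x ≠ l) (hxh : x ≠ h) {J : Set V} (hlJ : l ∉ J) (hhJ : h ∉ J) (hxJ : x ∉ J)
    (hadj : ∀ u ∈ J, ∀ e y, ends e = s(u, y) → y ≠ h → y ≠ x → ∃ e', ends e' = s(y, h))
    (hout : ∀ y, y ≠ l → y ≠ h → y ≠ x → y ∉ J →
      (∃ e, ends e = s(y, l)) ∨ (∀ e, y ∈ ends e → x ∈ ends e)) : SwAll ends l h x := by
  refine swAll_of_gTyped_patterns hxl hxh fun d _ => ?_
  refine gTypedSwAll_of_adjJunctions (F := fun y => y = x ∨ y ∈ openNbrs ends d x)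
    (J := J \ openNbrs ends d x) hlh (isolate_hloop hxh hloop) (fun h' => hlJ h'.1)
    (fun h' => hhJ h'.1)
    (isUpperSet_markU d x) (isLowerSet_markD d x) (isLowerSet_markD'' d x) isUpperSet_univ ?_
    (fun T _ => Set.mem_univ _) (fun u hu h' => hxJ (h' ▸ hu.1)) (markF_exempt d) ?_ ?_
  · intro T hT y hy hyT
    rcases hyT with hyT | ⟨-, hyR⟩
    · exact hT y hy hyT
    · exact hyR hy
  · intro u hu
    exact hadj_isolate hxh (fun h' => hxJ (h' ▸ hu.1)) (hadj u hu.1)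
  · intro y hyl hyh hyJ
    by_cases hyx : y = x
    · exact Or.inl (Or.inl hyx)
    by_cases hyR : y ∈ openNbrs ends d x
    · exact Or.inl (Or.inr hyR)
    have hyJ' : y ∉ J := fun h' => hyJ ⟨h', hyR⟩
    rcases hout y hyl hyh hyx hyJ' with ⟨e, he⟩ | hiso
    · exact Or.inr (Or.inl ⟨e, isolate_eq_of_ends_eq hyx hxl.symm he⟩)
    · exact Or.inr (Or.inr (isolate_iso hyx hiso))

/-- **Row (SW) from the general mark step with any set of junctions.** -/
theorem sw_markStep_of_adjJunctions (hlh : l ≠ h) (hloop : ∀ e, ends e ≠ s(h, h))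
    (hxl : x ≠ l) (hxh : x ≠ h) {J : Set V} (hlJ : l ∉ J) (hhJ : h ∉ J) (hxJ : x ∉ J)
    (hadj : ∀ u ∈ J, ∀ e y, ends e = s(u, y) → y ≠ h → y ≠ x → ∃ e', ends e' = s(y, h))
    (hout : ∀ y, y ≠ l → y ≠ h → y ≠ x → y ∉ J →
      (∃ e, ends e = s(y, l)) ∨ (∀ e, y ∈ ends e → x ∈ ends e)) : Sw ends l h x :=
  sw_of_swAll ends (swAll_markStep_of_adjJunctions hlh hloop hxl hxh hlJ hhJ hxJ hadj hout)

/-- `0–1, 0–2, 1–3, 1–4, 2–3, 2–4, 3–4`: the mark `2` touches the adjacent junctions `3`, `4`. -/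
def exA : Fin 7 → Sym2 (Fin 5)
  | 0 => s(0, 1) | 1 => s(0, 2) | 2 => s(1, 3) | 3 => s(1, 4) | 4 => s(2, 3) | 5 => s(2, 4)
  | 6 => s(3, 4)

/-- **Row 2′SW-ALL on `exA`** with `l = 0`, `h = 1`, the mark `2`: the adjacent junctions `3 ~ 4`
(both joined to `h` and to the mark, neither to `l`). -/
theorem swAll_exA : SwAll exA 0 1 2 := by
  refine swAll_markStep_of_adjJunctions (J := {3, 4}) (by decide) (by decide) (by decide)
    (by decide) (by simp) (by simp) (by simp) ?_ ?_
  · intro u hu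
    simp only [Set.mem_insert_iff, Set.mem_singleton_iff] at hu
    rcases hu with rfl | rfl <;> decide
  · intro y hy0 hy1 hy2 hyJ
    fin_cases y
    · exact absurd rfl hy0
    · exact absurd rfl hy1
    · exact absurd rfl hy2
    · exact absurd (by simp) hyJ
    · exact absurd (by simp) hyJ

/-- **Row (SW) on `exA`.** -/
theorem sw_exA : Sw exA 0 1 2 := sw_of_swAll exA swAll_exA

end LocRows

end Summit.Ventures.PercRepro2
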